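import Summits.ValiantsHypothesis.ValiantsHypothesis.Theorems.LacunarySymmetroidMatrixDescartesFiniteSectorHeightDefs
import Summits.ValiantsHypothesis.ValiantsHypothesis.Theorems.LacunarySymmetroidMatrixDescartesStubArith4

/-!
# `MatrixDescartes` — line «range» ported (R): the coefficient DYNAMIC RANGE of a full-positive-rooted determinant
# (one bit of range per root), the HEIGHT LAW `2^n·√|c₀·lc| ≤ m!(Kh)^m`, the height-`H` stamp rows, the integer
# corollary, the FULL SECTOR of the quasi-polynomial-height rung, and the reduction of the rung to its non-full sector

HONEST FRAMING.  Port (val-lit port pool, seat `val-port-2`; director-valiant g11-R94 (b) / R102–R104 (a), val-lit desk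
RULING #224) of the PROVED part §1–§8 of the crux workfile `Cruxes/MatrixDescartes/Lines/range.lean` (val-idea-6 g4,
LINE «range», lens «control» + «assume the law fails»; val-idea-crit-2 VERDICT #26 = PASS, structure + instrument tier,
0 provers), token-for-token up to the port notes: namespace out of `Theses.…RangeLine` into `…Theorems.…Range`;
vocabulary REUSED by name — `pencil`, `IsFullPosRooted` (`…FiniteSectorDefs`, val-sym-eng-3) and `HeightStampLawAt`,
`pencilZ`, `castZ`, `HeightMatrixDescartes`, `HeightMDRNonFull` (companion (D) `…FiniteSectorHeightDefs`); the workfile's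
re-declared copies and unused `StampLawAt` / `FullyRealisable` dropped; no Theses import.  Split of record: (D) defs · (R)
this file · (P) `…ProfileLaw.lean` (val-port-1) · (§9) obligations file (val-port-4).  Helper mode (`--supports
stmt-ValiantsHypothesis-18050 --as helper`).  The crux `…Theses.LacunarySymmetroid.MatrixDescartes` (stmt-18050) is
HEIGHT-FREE and asymptotic in `K`; everything here is HEIGHT-SENSITIVE and on the FULL (stamp) sector, so nothing here
closes or bears on the crux, on Conjecture B (`KPlusLogSqLaw`, Descartes-trivial at `m = 2`) or on `VP ≠ VNP`.  NOT
ported: the on-path one-liner `MatrixDescartes → HeightMatrixDescartes` (needs the Theses import; stays in the skeleton)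
and §9 (`ErdosTuranPositiveAxis`, `DetL1Bound`, `violator_degree` — the (§9) file).

CONTENT (control quantity: the dynamic range `‖q‖₁/√|c₀(q)·lc(q)|` of `q = det P`, read through `|q(−1)|`).
§1 root bookkeeping for full-positive-rooted polynomials · §2 two multiset inequalities (AM–GM `2^|s|·√∏s ≤ ∏(a+1)`) ·
§3 **range law** `rangeLaw_fullPos`: `2^{deg q}·√|q(0)·lc q| ≤ |q(−1)| ≤ ‖q‖₁`, one bit of range per root, sharp at
`c·(X−1)^n` · §4 pencils: `eval_det_pencil`, `|det Σ t^{d_l}S_l| ≤ m!(Kh)^m` for `|t| ≤ 1` (`Matrix.det_le`) and the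
**height law** `heightLaw`: `2^{deg det P}·√|c₀·lc| ≤ m!(Kh)^m` (letters `|S_l i j| ≤ h`, symmetry unused) · §5 the
height-`H` stamp row decided for every `m` by `m!(KH)^m < 2^{B+1}` (`heightStampLawAt_of_lt`) and the five INSTRUMENT
rows `(m,K,H,B) = (2,5,9,11), (2,6,30,15), (2,7,103,19), (2,8,724,25), (2,9,5148,31)` (integer certificates for the
stamp numbers `16/20/26/32` of «stamp»'s `G6–G9` need an entry `≥ 31/104/725/5149`, the located `ν(2,5)=12` format an
entry `≥ 10`; scale-free reading: `log₂(‖det P‖₁/√|c₀c_n|) ≥ n` on full candidates) · §6 integer letters normalise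
themselves, `natDegree_le_of_int` · §7 **full sector of the rung, proved** (`heightMDR_fullSector`: regime
`m ≤ 2^{(⌊log₂K⌋+c)^c}`, letters `≤ 2^{(⌊log₂K⌋+c)^c}`, `|c₀·lc| ≥ 1` ⇒ `(#roots)^q ≤ 2^{K⌊log₂K⌋}` for `K ≥ K₀(c,q)`;
range law + `Matrix.det_le` + `StubArith4.exp_le`) · §8 `heightMDR_of_nonFull : HeightMDRNonFull → HeightMatrixDescartes`.
[folklore] throughout (Descartes/AM–GM bookkeeping, Hadamard-type bounds, ℕ-arithmetic); literature context in the card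
(Schur–Siegel circle; Erdős–Turán 1950 doi:10.2307/1969500; Borwein–Erdélyi–Kós 1999) — none is cited as a fact here.
-/

-- single-conjunct layout (D-0017): Sub = Summit duplicates a namespace component; the name is mandated
set_option linter.dupNamespace false

namespace Summit.ValiantsHypothesis.ValiantsHypothesis.Theorems.LacunarySymmetroidMatrixDescartes.Range

open Summit.ValiantsHypothesis.ValiantsHypothesis.Theorems.LacunarySymmetroidMatrixDescartes.FiniteSector
  (pencil IsFullPosRooted HeightStampLawAt pencilZ castZ HeightMatrixDescartes HeightMDRNonFull)
open scoped BigOperators Matrix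
open Polynomial

/-! ## §1 Root bookkeeping for full-positive-rooted polynomials -/

/-- A full-positive-rooted polynomial has exactly `natDegree` roots counted with multiplicity. [folklore] -/
theorem card_roots_of_fullPos {q : ℝ[X]} (h : IsFullPosRooted q) :
    Multiset.card q.roots = q.natDegree := by
  unfold IsFullPosRooted at h
  have h1 := Multiset.toFinset_card_le (q.roots.filter (0 < ·))
  have h2 := Multiset.card_le_card (Multiset.filter_le (0 < ·) q.roots)
  have h3 : Multiset.card q.roots ≤ q.natDegree := Polynomial.card_roots' q
  omega

/-- All roots of a full-positive-rooted polynomial pass the positivity filter. [folklore] -/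
theorem filter_roots_of_fullPos {q : ℝ[X]} (h : IsFullPosRooted q) :
    q.roots.filter (0 < ·) = q.roots := by
  have hc := card_roots_of_fullPos h
  unfold IsFullPosRooted at h
  have h1 := Multiset.toFinset_card_le (q.roots.filter (0 < ·))
  exact Multiset.eq_of_le_of_card_le (Multiset.filter_le _ _) (by omega)

/-- Every root of a full-positive-rooted polynomial is positive. [folklore] -/
theorem roots_pos_of_fullPos {q : ℝ[X]} (h : IsFullPosRooted q) : ∀ a ∈ q.roots, 0 < a :=
  Multiset.filter_eq_self.1 (filter_roots_of_fullPos h)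

/-- A full-positive-rooted polynomial has `natDegree` DISTINCT roots. [folklore] -/
theorem toFinset_card_roots_of_fullPos {q : ℝ[X]} (h : IsFullPosRooted q) :
    q.roots.toFinset.card = q.natDegree := by
  have h' := h
  unfold IsFullPosRooted at h'
  rwa [filter_roots_of_fullPos h] at h'

/-- The root multiset of a full-positive-rooted polynomial is duplicate-free, i.e. it is the underlying multiset of
its root set. [folklore] -/
theorem roots_eq_toFinset_val_of_fullPos {q : ℝ[X]} (h : IsFullPosRooted q) :
    q.roots = q.roots.toFinset.val := by
  have hnd : q.roots.Nodup := by
    rw [← Multiset.toFinset_card_eq_card_iff_nodup, toFinset_card_roots_of_fullPos h, card_roots_of_fullPos h]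
  rw [Multiset.toFinset_val, Multiset.dedup_eq_self.2 hnd]

/-- A non-zero full-positive-rooted polynomial has non-zero constant term (`0` is not a root). [folklore] -/
theorem coeff_zero_ne_zero_of_fullPos {q : ℝ[X]} (hq : q ≠ 0) (hfull : IsFullPosRooted q) : q.coeff 0 ≠ 0 := by
  intro h0
  have hmem : (0:ℝ) ∈ q.roots := (mem_roots hq).2 (by rw [IsRoot, ← coeff_zero_eq_eval_zero, h0])
  exact lt_irrefl _ (roots_pos_of_fullPos hfull 0 hmem)

/-! ## §2 Two multiset inequalities -/

/-- For positive `a ∈ s` and `t ≤ 0`: `|∏ (t − a)| = ∏ (a − t)`. [folklore] -/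
theorem abs_prod_map_sub {s : Multiset ℝ} (hs : ∀ a ∈ s, 0 < a) {t : ℝ} (ht : t ≤ 0) :
    |(s.map (fun a => t - a)).prod| = (s.map (fun a => a - t)).prod := by
  induction s using Multiset.induction_on with
  | empty => simp
  | cons a s ih =>
    have ha : 0 < a := hs a (Multiset.mem_cons_self a s)
    have ih' := ih (fun b hb => hs b (Multiset.mem_cons_of_mem hb))
    simp only [Multiset.map_cons, Multiset.prod_cons, abs_mul, ih']
    rw [abs_of_nonpos (by linarith)]; ring

/-- AM–GM letter by letter: `2^|s| · √(∏ s) ≤ ∏ (a + 1)` for a multiset of positive reals; equality iff all `a = 1`.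
[folklore] -/
theorem two_pow_mul_sqrt_prod_le {s : Multiset ℝ} (hs : ∀ a ∈ s, 0 < a) :
    (2:ℝ) ^ Multiset.card s * Real.sqrt s.prod ≤ (s.map (fun a => a + 1)).prod := by
  induction s using Multiset.induction_on with
  | empty => simp
  | cons a s ih =>
    have ha : 0 < a := hs a (Multiset.mem_cons_self a s)
    have hs' : ∀ b ∈ s, 0 < b := fun b hb => hs b (Multiset.mem_cons_of_mem hb)
    have ih' := ih hs'
    have h2a : 2 * Real.sqrt a ≤ a + 1 := by
      nlinarith [Real.sq_sqrt ha.le, sq_nonneg (Real.sqrt a - 1), Real.sqrt_nonneg a]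
    simp only [Multiset.card_cons, Multiset.prod_cons, Multiset.map_cons]
    calc (2:ℝ) ^ (Multiset.card s + 1) * Real.sqrt (a * s.prod)
        = (2 * Real.sqrt a) * ((2:ℝ) ^ Multiset.card s * Real.sqrt s.prod) := by
          rw [pow_succ, Real.sqrt_mul ha.le]; ring
      _ ≤ (a + 1) * (s.map (fun a => a + 1)).prod :=
          mul_le_mul h2a ih' (by positivity) (by linarith)

/-! ## §3 THE RANGE LAW for full-positive-rooted polynomials (elementary, sharp at `c·(X−1)^n`) -/

/-- Factorised evaluation of a full-positive-rooted polynomial: `q(t) = lc(q) · ∏_{roots} (t − a)`. [folklore] -/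
theorem eval_eq_of_fullPos {q : ℝ[X]} (h : IsFullPosRooted q) (t : ℝ) :
    q.eval t = q.leadingCoeff * (q.roots.map (fun a => t - a)).prod := by
  have hfac := Polynomial.C_leadingCoeff_mul_prod_multiset_X_sub_C (card_roots_of_fullPos h)
  have hm : q.roots.map ((eval t) ∘ fun a => X - C a) = q.roots.map (fun a => t - a) :=
    Multiset.map_congr rfl (fun a _ => by simp)
  calc q.eval t = (C q.leadingCoeff * (q.roots.map fun a => X - C a).prod).eval t := by rw [hfac]
    _ = q.leadingCoeff * (q.roots.map (fun a => t - a)).prod := by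
        rw [eval_mul, eval_C, eval_multiset_prod, Multiset.map_map, hm]

/-- **Range law.** A real polynomial with `natDegree q` distinct positive roots satisfies
`2^{deg q} · √|q(0)·lc(q)| ≤ |q(−1)|`. [folklore: AM–GM on `∏(1+ρᵢ) ≥ 2^n √∏ρᵢ`] -/
theorem rangeLaw_fullPos (q : ℝ[X]) (h : IsFullPosRooted q) :
    (2:ℝ) ^ q.natDegree * Real.sqrt (|q.coeff 0 * q.leadingCoeff|) ≤ |q.eval (-1)| := by
  by_cases hq : q = 0
  · subst hq; simp
  have hcard := card_roots_of_fullPos h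
  have hpos := roots_pos_of_fullPos h
  have h0 : |q.coeff 0| = |q.leadingCoeff| * q.roots.prod := by
    rw [coeff_zero_eq_eval_zero, eval_eq_of_fullPos h 0, abs_mul, abs_prod_map_sub hpos le_rfl]
    simp
  have h1 : |q.eval (-1)| = |q.leadingCoeff| * (q.roots.map (fun a => a + 1)).prod := by
    rw [eval_eq_of_fullPos h (-1), abs_mul, abs_prod_map_sub hpos (by norm_num)]
    congr 2; exact Multiset.map_congr rfl (fun a _ => by ring)
  have hlc : 0 ≤ |q.leadingCoeff| := abs_nonneg _
  have key := two_pow_mul_sqrt_prod_le hpos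
  rw [hcard] at key
  calc (2:ℝ) ^ q.natDegree * Real.sqrt (|q.coeff 0 * q.leadingCoeff|)
      = |q.leadingCoeff| * ((2:ℝ) ^ q.natDegree * Real.sqrt q.roots.prod) := by
        rw [abs_mul, h0, show |q.leadingCoeff| * q.roots.prod * |q.leadingCoeff|
              = (|q.leadingCoeff| * |q.leadingCoeff|) * q.roots.prod by ring,
            Real.sqrt_mul (mul_nonneg hlc hlc), Real.sqrt_mul_self hlc]
        ring
    _ ≤ |q.leadingCoeff| * (q.roots.map (fun a => a + 1)).prod := mul_le_mul_of_nonneg_left key hlc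
    _ = |q.eval (-1)| := h1.symm

/-- The evaluation at `−1` is dominated by the `ℓ¹`-norm of the coefficients. [folklore] -/
theorem abs_eval_neg_one_le_sum (q : ℝ[X]) :
    |q.eval (-1)| ≤ ∑ r ∈ Finset.range (q.natDegree + 1), |q.coeff r| := by
  rw [eval_eq_sum_range]
  refine (Finset.abs_sum_le_sum_abs _ _).trans (le_of_eq ?_)
  refine Finset.sum_congr rfl (fun r _ => ?_)
  rw [abs_mul, abs_pow, abs_neg, abs_one, one_pow, mul_one]

/-- Corollary: `2^{deg} · √|c₀ · c_n| ≤ ‖q‖₁` — the coefficient DYNAMIC RANGE carries at least one bit per root.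
[folklore] -/
theorem rangeLaw_fullPos_l1 (q : ℝ[X]) (h : IsFullPosRooted q) :
    (2:ℝ) ^ q.natDegree * Real.sqrt (|q.coeff 0 * q.leadingCoeff|)
      ≤ ∑ r ∈ Finset.range (q.natDegree + 1), |q.coeff r| :=
  (rangeLaw_fullPos q h).trans (abs_eval_neg_one_le_sum q)

/-! ## §4 Pencils: evaluation and the determinant height bound -/

/-- Evaluating `det (pencil d S)` at `t` gives `det (Σ_l t^{d_l} S_l)` (`det` commutes with evaluation). [folklore] -/
theorem eval_det_pencil {m K : ℕ} (d : Fin K → ℕ) (S : Fin K → Matrix (Fin m) (Fin m) ℝ) (t : ℝ) :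
    (pencil d S).det.eval t = (∑ l, t ^ d l • S l).det := by
  have h : (pencil d S).det.eval t = ((evalRingHom t).mapMatrix (pencil d S)).det :=
    RingHom.map_det (evalRingHom t) (pencil d S)
  rw [h]
  congr 1
  ext i j
  simp only [pencil, RingHom.mapMatrix_apply, Matrix.map_apply, Matrix.sum_apply, Matrix.smul_apply,
    smul_eq_mul, coe_evalRingHom, eval_finsetSum, eval_mul, eval_pow, eval_X, eval_C]

/-- Hadamard-type bound: letters `|S_l i j| ≤ h` and `|t| ≤ 1` give `|det Σ_l t^{d_l} S_l| ≤ m!·(K h)^m`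
(`Matrix.det_le` with entries bounded by `K h`). [folklore] -/
theorem abs_det_sum_smul_le {m K : ℕ} (d : Fin K → ℕ) (S : Fin K → Matrix (Fin m) (Fin m) ℝ) {h : ℝ}
    (hS : ∀ l i j, |S l i j| ≤ h) {t : ℝ} (ht : |t| ≤ 1) :
    |(∑ l, t ^ d l • S l).det| ≤ (m.factorial : ℝ) * (K * h) ^ m := by
  have hent : ∀ i j, |(∑ l, t ^ d l • S l) i j| ≤ K * h := by
    intro i j
    rw [Matrix.sum_apply]
    calc |∑ l, (t ^ d l • S l) i j| ≤ ∑ l, |(t ^ d l • S l) i j| := Finset.abs_sum_le_sum_abs _ _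
      _ ≤ ∑ _l : Fin K, h := Finset.sum_le_sum (fun l _ => by
          rw [Matrix.smul_apply, smul_eq_mul, abs_mul, abs_pow]
          calc |t| ^ d l * |S l i j| ≤ 1 * |S l i j| :=
                mul_le_mul_of_nonneg_right (pow_le_one₀ (abs_nonneg t) ht) (abs_nonneg _)
            _ ≤ h := by rw [one_mul]; exact hS l i j)
      _ = K * h := by simp
  have key := Matrix.det_le (abv := AbsoluteValue.abs) (A := ∑ l, t ^ d l • S l) (x := (K : ℝ) * h)
    (fun i j => by rw [AbsoluteValue.abs_apply]; exact hent i j)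
  rw [AbsoluteValue.abs_apply, Fintype.card_fin, nsmul_eq_mul] at key
  exact key

/-- **Height law for full-positive-rooted pencils** (any real letters bounded by `h`, any exponents, symmetry unused):
`2^{deg det P} · √|c₀ · lc| ≤ m! · (K h)^m` — one root per bit of letter height. [folklore] -/
theorem heightLaw {m K : ℕ} (d : Fin K → ℕ) (S : Fin K → Matrix (Fin m) (Fin m) ℝ) {h : ℝ}
    (hS : ∀ l i j, |S l i j| ≤ h) (hfull : IsFullPosRooted (pencil d S).det) :
    (2:ℝ) ^ (pencil d S).det.natDegree
        * Real.sqrt (|(pencil d S).det.coeff 0 * (pencil d S).det.leadingCoeff|)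
      ≤ (m.factorial : ℝ) * (K * h) ^ m := by
  have h1 := rangeLaw_fullPos _ hfull
  rw [eval_det_pencil] at h1
  exact h1.trans (abs_det_sum_smul_le d S hS (by norm_num))

/-! ## §5 The height-`H` stamp row «`ν_H(m,K) ≤ B`» (`HeightStampLawAt` of (D)) and its numeric instances -/

/-- The height law decides the height-`H` stamp row, for every size `m`: `m!·(K H)^m < 2^{B+1} ⇒ ν_H(m,K) ≤ B`, i.e.
every full-positive-rooted `(m,K)` pencil with letters `|S_l i j| ≤ H` and `1 ≤ |c₀ · lc|` has `natDegree ≤ B`.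
[folklore] -/
theorem heightStampLawAt_of_lt {m K B : ℕ} {H : ℝ}
    (hB : (m.factorial : ℝ) * (K * H) ^ m < 2 ^ (B + 1)) : HeightStampLawAt m K H B := by
  intro d S hS hends hfull
  have h1 := heightLaw d S hS hfull
  have h2 : (1:ℝ) ≤ Real.sqrt (|(pencil d S).det.coeff 0 * (pencil d S).det.leadingCoeff|) := by
    rw [show (1:ℝ) = Real.sqrt 1 by simp]
    exact Real.sqrt_le_sqrt hends
  have h3 : (2:ℝ) ^ (pencil d S).det.natDegree ≤ (m.factorial : ℝ) * (K * H) ^ m :=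
    (le_mul_of_one_le_right (by positivity) h2).trans h1
  by_contra hlt
  have h4 : (2:ℝ) ^ (B + 1) ≤ (2:ℝ) ^ (pencil d S).det.natDegree :=
    pow_le_pow_right₀ (by norm_num) (by omega)
  linarith

/-- Row `(2,5)` at height `9`: no full `2×2` 5-term pencil of degree `≥ 12` (the located `ν(2,5) = n(2,4) = 12` format)
has letters bounded by `9` — integer realisations of the stamp number `12` need an entry `≥ 10`
(`2·(5·9)² = 4050 < 2¹²`). [folklore] -/
theorem heightStampLaw_2_5 : HeightStampLawAt 2 5 9 11 :=
  heightStampLawAt_of_lt (by norm_num [Nat.factorial])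

/-- Row `G6` at height `30`: no full `2×2` 6-term pencil of degree `≥ 16 = n(2,5)` with letters `≤ 30` — integer
certificates for «stamp»'s `G6` need an entry `≥ 31` (`2·(6·30)² = 64800 < 2¹⁶`). [folklore] -/
theorem heightStampLaw_G6 : HeightStampLawAt 2 6 30 15 :=
  heightStampLawAt_of_lt (by norm_num [Nat.factorial])

/-- Row `G7` at height `103`: degree `≥ 20 = n(2,6)` needs an entry `≥ 104` (`2·(7·103)² = 1 039 682 < 2²⁰`).
[folklore] -/
theorem heightStampLaw_G7 : HeightStampLawAt 2 7 103 19 :=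
  heightStampLawAt_of_lt (by norm_num [Nat.factorial])

/-- Row `G8` at height `724` (the divergence cell `(2,8)`): degree `≥ 26 = n(2,7)` needs an entry `≥ 725`
(`2·(8·724)² = 67 094 528 < 2²⁶`); in particular «eleven-thirds at `K = 8`» survives every full integer pencil of
height `≤ 724`. [folklore] -/
theorem heightStampLaw_G8 : HeightStampLawAt 2 8 724 25 :=
  heightStampLawAt_of_lt (by norm_num [Nat.factorial])

/-- Row `G9` at height `5148`: degree `≥ 32 = n(2,8)` needs an entry `≥ 5149` (`2·(9·5148)² = 4 293 308 448 < 2³²`).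
[folklore] -/
theorem heightStampLaw_G9 : HeightStampLawAt 2 9 5148 31 :=
  heightStampLawAt_of_lt (by norm_num [Nat.factorial])

/-! ## §6 Integer letters normalise themselves: `|c₀ · lc| ≥ 1` (`pencilZ`, `castZ` of (D)) -/

/-- The determinant of the realified integer pencil is the image of the integer determinant under `ℤ[X] → ℝ[X]`.
[folklore] -/
theorem det_pencil_castZ {m K : ℕ} (d : Fin K → ℕ) (Z : Fin K → Matrix (Fin m) (Fin m) ℤ) :
    (pencil d (castZ Z)).det = Polynomial.map (Int.castRingHom ℝ) (pencilZ d Z).det := by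
  have h : Polynomial.map (Int.castRingHom ℝ) (pencilZ d Z).det
      = ((mapRingHom (Int.castRingHom ℝ)).mapMatrix (pencilZ d Z)).det :=
    RingHom.map_det (mapRingHom (Int.castRingHom ℝ)) (pencilZ d Z)
  rw [h]
  congr 1
  ext i j
  simp [pencil, pencilZ, castZ, Matrix.sum_apply]

/-- For integer letters with non-degenerate full-positive-rooted determinant, `1 ≤ |c₀ · lc|`. [folklore] -/
theorem one_le_abs_ends_of_int {m K : ℕ} (d : Fin K → ℕ) (Z : Fin K → Matrix (Fin m) (Fin m) ℤ)
    (hfull : IsFullPosRooted (pencil d (castZ Z)).det) (hq : (pencil d (castZ Z)).det ≠ 0) :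
    1 ≤ |(pencil d (castZ Z)).det.coeff 0 * (pencil d (castZ Z)).det.leadingCoeff| := by
  have hmap := det_pencil_castZ d Z
  have hc0ne := coeff_zero_ne_zero_of_fullPos hq hfull
  have hc0 : (pencil d (castZ Z)).det.coeff 0 = (((pencilZ d Z).det.coeff 0 : ℤ) : ℝ) := by
    rw [hmap, coeff_map]; rfl
  have hlc : (pencil d (castZ Z)).det.leadingCoeff = (((pencilZ d Z).det.leadingCoeff : ℤ) : ℝ) := by
    rw [hmap, leadingCoeff_map_of_injective Int.cast_injective]; rfl
  have hP0 : (pencilZ d Z).det.coeff 0 ≠ 0 := by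
    intro h; apply hc0ne; rw [hc0, h]; simp
  have hPl : (pencilZ d Z).det.leadingCoeff ≠ 0 := by
    intro h; apply hq; rw [← leadingCoeff_eq_zero, hlc, h]; simp
  rw [hc0, hlc, ← Int.cast_mul, ← Int.cast_abs, show (1:ℝ) = ((1:ℤ) : ℝ) by norm_num, Int.cast_le]
  exact Int.one_le_abs (mul_ne_zero hP0 hPl)

/-- **Integer corollary.** A height-`H` stamp row bounds the degree of every full-positive-rooted INTEGER pencil with
entries `≤ H` and `det ≢ 0`: e.g. with `heightStampLaw_G6`, no integer `2×2` 6-term pencil with entries in `[-30,30]`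
realises degree `16` (so `G6`'s integer certificates have an entry `≥ 31`; `G8`: `≥ 725`; `G9`: `≥ 5149`). [folklore] -/
theorem natDegree_le_of_int {m K B : ℕ} {H : ℝ} (hlaw : HeightStampLawAt m K H B) (d : Fin K → ℕ)
    (Z : Fin K → Matrix (Fin m) (Fin m) ℤ) (hZ : ∀ l i j, |((Z l i j : ℤ) : ℝ)| ≤ H)
    (hfull : IsFullPosRooted (pencil d (castZ Z)).det) (hq : (pencil d (castZ Z)).det ≠ 0) :
    (pencil d (castZ Z)).det.natDegree ≤ B :=
  hlaw d _ (fun l i j => by simpa [castZ, Matrix.map_apply] using hZ l i j)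
    (one_le_abs_ends_of_int d Z hfull hq) hfull

/-! ## §7 The FULL SECTOR of the quasi-polynomial-height rung (proved) -/

/-- Polylog bookkeeping: `3(L+c)^c + L + 1 ≤ (L+c+4)^(c+4)`. [folklore] -/
theorem poly_bound (L c : ℕ) : 3 * (L + c) ^ c + L + 1 ≤ (L + (c + 4)) ^ (c + 4) := by
  set T := L + (c + 4) with hT
  have hT4 : 4 ≤ T := by omega
  have hTc : 1 ≤ T ^ c := Nat.one_le_pow _ _ (by omega)
  have hLc : (L + c) ^ c ≤ T ^ c := Nat.pow_le_pow_left (by omega) c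
  have h4 : 4 * T ≤ T ^ 4 := by
    calc 4 * T ≤ T * T := Nat.mul_le_mul_right T hT4
      _ ≤ T * T * (T * T) := Nat.le_mul_of_pos_right _ (by positivity)
      _ = T ^ 4 := by ring
  calc 3 * (L + c) ^ c + L + 1 ≤ 3 * T ^ c + T := by omega
    _ ≤ T ^ c * (4 * T) := by nlinarith [hTc, hT4]
    _ ≤ T ^ c * T ^ 4 := Nat.mul_le_mul_left _ h4
    _ = T ^ (c + 4) := by rw [← pow_add]

/-- **The FULL SECTOR of the rung «height-MDR», proved** (range law + `Matrix.det_le` + `StubArith4.exp_le`): in the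
crux's regime `m ≤ 2^{(⌊log₂K⌋+c)^c}`, every full-positive-rooted pencil with letters of height `≤ 2^{(⌊log₂K⌋+c)^c}`
and `|c₀·lc| ≥ 1` has `(#roots)^q ≤ 2^{K⌊log₂K⌋}` for `K ≥ K₀(c,q)`.  Symmetry is not used.  (The rung itself — the
crux at quasi-polynomial letter height with `|trailing·leading| ≥ 1` — is a CONSEQUENCE of the crux and stays a typed
obligation of the line; this theorem discharges its full sector, so only the non-full sector is left.) [folklore] -/
theorem heightMDR_fullSector (c q : ℕ) : ∃ K₀ : ℕ, ∀ K m : ℕ, K₀ ≤ K → m ≤ 2 ^ ((Nat.log 2 K + c) ^ c) →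
      ∀ (d : Fin K → ℕ) (S : Fin K → Matrix (Fin m) (Fin m) ℝ),
        (∀ l i j, |S l i j| ≤ (2:ℝ) ^ ((Nat.log 2 K + c) ^ c)) →
        1 ≤ |(pencil d S).det.coeff 0 * (pencil d S).det.leadingCoeff| →
        IsFullPosRooted (pencil d S).det →
        (pencil d S).det.roots.toFinset.card ^ q ≤ 2 ^ (K * Nat.log 2 K) := by
  obtain ⟨K₁, hK₁⟩ :=
    Summit.ValiantsHypothesis.ValiantsHypothesis.Theorems.LacunarySymmetroidMatrixDescartes.StubArith4.exp_le (c + 4) q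
  refine ⟨K₁, fun K m hK hm d S hS hends hfull => ?_⟩
  set L := Nat.log 2 K with hL
  set P := (L + c) ^ c with hPdef
  set n := (pencil d S).det.natDegree with hn
  have h1 : (2:ℝ) ^ n ≤ (m.factorial : ℝ) * (K * (2:ℝ) ^ P) ^ m := by
    have hh := heightLaw d S hS hfull
    have h2 : (1:ℝ) ≤ Real.sqrt (|(pencil d S).det.coeff 0 * (pencil d S).det.leadingCoeff|) := by
      rw [show (1:ℝ) = Real.sqrt 1 by simp]
      exact Real.sqrt_le_sqrt hends
    exact (le_mul_of_one_le_right (by positivity) h2).trans hh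
  have h2 : 2 ^ n ≤ m.factorial * (K * 2 ^ P) ^ m := by exact_mod_cast h1
  have hK2 : K ≤ 2 ^ (L + 1) := (Nat.lt_pow_succ_log_self one_lt_two K).le
  have hE : m * (K * 2 ^ P) ≤ 2 ^ (P + (L + 1) + P) := by
    calc m * (K * 2 ^ P) ≤ 2 ^ P * (2 ^ (L + 1) * 2 ^ P) :=
          Nat.mul_le_mul hm (Nat.mul_le_mul_right _ hK2)
      _ = 2 ^ (P + (L + 1) + P) := by rw [pow_add, pow_add]; ring
  have h3 : m.factorial * (K * 2 ^ P) ^ m ≤ (2 ^ (P + (L + 1) + P)) ^ (2 ^ P) := by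
    calc m.factorial * (K * 2 ^ P) ^ m ≤ m ^ m * (K * 2 ^ P) ^ m :=
          Nat.mul_le_mul_right _ (Nat.factorial_le_pow m)
      _ = (m * (K * 2 ^ P)) ^ m := by rw [← mul_pow]
      _ ≤ (2 ^ (P + (L + 1) + P)) ^ m := Nat.pow_le_pow_left hE m
      _ ≤ (2 ^ (P + (L + 1) + P)) ^ (2 ^ P) := Nat.pow_le_pow_right (by positivity) hm
  have h4 : n ≤ (P + (L + 1) + P) * 2 ^ P := by
    have : 2 ^ n ≤ 2 ^ ((P + (L + 1) + P) * 2 ^ P) := by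
      calc 2 ^ n ≤ _ := h2
        _ ≤ _ := h3
        _ = 2 ^ ((P + (L + 1) + P) * 2 ^ P) := by rw [← pow_mul]
    exact (Nat.pow_le_pow_iff_right (by norm_num)).1 this
  have h5 : n ≤ 2 ^ (3 * P + L + 1) := by
    calc n ≤ (P + (L + 1) + P) * 2 ^ P := h4
      _ ≤ 2 ^ (P + (L + 1) + P) * 2 ^ P := Nat.mul_le_mul_right _ (Nat.lt_two_pow_self).le
      _ = 2 ^ (3 * P + L + 1) := by rw [← pow_add]; ring_nf
  have h6 : 3 * P + L + 1 ≤ (L + (c + 4)) ^ (c + 4) := poly_bound L c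
  have h7 : q * (L + (c + 4)) ^ (c + 4) ≤ K * L := hK₁ K hK
  rw [toFinset_card_roots_of_fullPos hfull]
  calc n ^ q ≤ (2 ^ (3 * P + L + 1)) ^ q := Nat.pow_le_pow_left h5 q
    _ = 2 ^ (q * (3 * P + L + 1)) := by rw [← pow_mul, mul_comm]
    _ ≤ 2 ^ (q * (L + (c + 4)) ^ (c + 4)) := Nat.pow_le_pow_right (by norm_num) (Nat.mul_le_mul_left q h6)
    _ ≤ 2 ^ (K * L) := Nat.pow_le_pow_right (by norm_num) h7

/-! ## §8 The rung reduces to its NON-FULL sector (proved split) -/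

/-- **Composition.** The non-full sector `HeightMDRNonFull` is all that is left of the rung `HeightMatrixDescartes`:
on full-positive-rooted determinants the full-sector theorem `heightMDR_fullSector` applies (there `trailingCoeff = coeff 0`
since `0` is not a root).  Both propositions are OPEN obligations of the line recorded in (D); this lemma asserts neither.
[folklore] -/
theorem heightMDR_of_nonFull (h : HeightMDRNonFull) : HeightMatrixDescartes := by
  intro c q hq
  obtain ⟨K₀, hK₀⟩ := h c q hq
  obtain ⟨K₁, hK₁⟩ := heightMDR_fullSector c q
  refine ⟨max K₀ K₁, fun K m hK hm d S hS hH hends => ?_⟩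
  by_cases hfull : IsFullPosRooted (pencil d S).det
  · have hq0 : (pencil d S).det ≠ 0 := by
      intro h0; rw [h0] at hends; norm_num at hends
    have htr : (pencil d S).det.trailingCoeff = (pencil d S).det.coeff 0 :=
      trailingCoeff_eq_coeff_zero (coeff_zero_ne_zero_of_fullPos hq0 hfull)
    exact hK₁ K m (le_of_max_le_right hK) hm d S hH (by rw [← htr]; exact hends) hfull
  · exact hK₀ K m (le_of_max_le_left hK) hm d S hS hH hends hfull

end Summit.ValiantsHypothesis.ValiantsHypothesis.Theorems.LacunarySymmetroidMatrixDescartes.Range
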